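import Summits.BirchSwinnertonDyer.BirchSwinnertonDyer.Theorems.ClassRecordThreeEulerHalvesAtThreeCartanCoverPrintClausesQuotientSurface
import Summits.BirchSwinnertonDyer.BirchSwinnertonDyer.Theorems.ClassRecordThreeEulerHalvesAtThreeCartanCoverPrintClausesSurjectiveDivision
import Summits.BirchSwinnertonDyer.BirchSwinnertonDyer.Theorems.ClassRecordThreeEulerHalvesAtThreeCartanCoverPrintClausesDescent
import Summits.BirchSwinnertonDyer.BirchSwinnertonDyer.Theorems.ClassRecordThreeEulerHalvesAtThreeCartanCoverPrintClausesFinitelyGenerated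
import Literature.NumberTheory.Automorphic.EichlerShimuraWeightTwoSplitInjective
import Literature.NumberTheory.Automorphic.QuaternionOrderUnitsCocompact
import Literature.NumberTheory.Automorphic.FuchsianEichlerShimuraWeightTwo
import HarnessLib

/-!
# Crux NUM `CartanOnePlaceDegreeLawAtThree` (item 24801), line `petarea` — stub (D) `PeriodLatticeDiscrete`, slice 2:
# EICHLER–SHIMURA INJECTIVITY ON `S₂(Γ̄(q))` (the principal level of a Cartan datum, EVERY `D`), and `Γ̄(q)` is finitely generated

Seat `bsd-stepL-tam3-p1` g31 (LEAD of crux 24801; `--supports stmt-BirchSwinnertonDyer-24801 --as helper`). The analytic input of the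
registered content stub `stub_periodLatticeDiscrete` of `Cruxes/CartanOnePlaceDegreeLawAtThree/Lines/petarea.lean` v4: for a Cartan datum
`X : CartanLevelCurveData D M C`, `q ≠ 0`, and the principal level `Γ̄(q) = CartanCover.principalLevel X q ⊴ ι(O₀'¹) = coverUnits X q`
(finite index, tree `isFiniteRelIndex_principalLevel`):

* `principalLevel_eq_zero_of_forall_rePeriod_eq_zero` — **a weight-two cusp form on `Γ̄(q)` all of whose real periods `Re ∫_{z₀}^{γ z₀} F`
  vanish is zero** (`…_of_forall_period_eq_zero`: the same with complex periods). By the dichotomy «`X.B` is a division algebra ∕ has a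
  non-zero non-unit» (plain logic — no hypothesis on `D`): DIVISION — `Γ̄(q)` is cocompact (`principalLevel_exists_isCompact_reps_of_forall_isUnit`:
  the cover group `ι(O₀'¹)` is, tree `exists_isCompact_forall_exists_mem_normOneUnits_smul_mem`, spread over the finitely many cosets
  `exists_finset_leftCosets_principalLevel` by `exists_isCompact_reps_of_finset_leftCosets`) and a form with purely imaginary periods on a cocompact
  group vanishes (maximum modulus for `exp ∘ ∫F`; Shimura Thm. 8.4, adapted privately from the tree's `ShimuraCurvePeriodsHeckeIntegralityProofs` §3 whose
  closure has no hub olean); SPLIT — an arithmetic `det = 1` group `A` conjugates into `ι(O₀'¹)` by `g` of positive determinant (tree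
  `exists_isArithmetic_conj_le_normOneUnits_of_exists_not_isUnit`); `g A g⁻¹ ⊓ Γ̄(q)` has finite index in `g A g⁻¹`, so `A ⊓ g⁻¹Γ̄(q)g` is again
  arithmetic (commensurability), and RESTRICTING `F` to `g A g⁻¹ ⊓ Γ̄(q)` and TRANSLATING by `g` reduces to the cusped injectivity theorem
  `CuspForm.eq_zero_of_forall_rePeriod_eq_zero_of_isArithmetic` (pattern of the tree's `CuspForm.eq_zero_of_forall_rePeriod_eq_zero_of_exists_not_isUnit`).
* `fg_principalLevel` — `Γ̄(q)` is finitely generated (the cover group is, tree `groupFG_normOneUnits`; Schreier, Mathlib `Subgroup.fg_of_index_ne_zero`).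

Nothing about NUM or any curve is proved; BSD is proved for no curve.
[cite: ShimuraIATAF1971, Thm. 8.4 p. 234, §1.3 Prop. 1.31, §9.2 p. 246] [cite: VignerasLNM800, Ch. IV §1 Thm. 1.1 and Prop. 1.4] [cite: Bergeron2016, §2.2 Lemma 2.7 p. 41]
-/

set_option linter.dupNamespace false
set_option autoImplicit false

noncomputable section

open scoped MatrixGroups ModularForm Pointwise
open UpperHalfPlane hiding I
open Function Set ConjAct

namespace Summit.BirchSwinnertonDyer.BirchSwinnertonDyer.Theorems.CartanCover.PrintClauses

open Literature.NumberTheory.Automorphic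

/-! ## §1 A weight-two form with purely imaginary periods on a cocompact group vanishes (private port) -/

section Cocompact

variable {Γ : Subgroup (GL (Fin 2) ℝ)} [Γ.HasDetOne]

/-- `Ψ(γτ) = Ψ(τ) + ∫_{τ₀}^{γτ₀} F` for the primitive `Ψ = ∫_{τ₀}^τ F` and `γ ∈ Γ`.
-- adapted from Literature/NumberTheory/Automorphic/ShimuraCurvePeriodsHeckeIntegralityProofs.lean §2 (no hub olean for that module in this closure)
[cite: ShimuraIATAF1971, §8.2 (8.2.19)–(8.2.20)] -/
private theorem segmentIntegral_smul_eq_add_period₄ (F : CuspForm Γ 2) {γ : GL (Fin 2) ℝ} (hγ : γ ∈ Γ) (τ₀ τ : ℍ) :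
    segmentIntegral F τ₀ (γ • τ) = segmentIntegral F τ₀ τ + segmentIntegral F τ₀ (γ • τ₀) := by
  have hdet : 0 < γ.det.val := by
    rw [Subgroup.HasDetOne.det_eq hγ, Units.val_one]; exact one_pos
  have hinv : segmentIntegral F (γ • τ₀) (γ • τ) = segmentIntegral F τ₀ τ := by
    rw [← segmentIntegral_slash_eq F hdet τ₀ τ, SlashInvariantForm.slash_action_eqn F γ hγ]
  have e2 := segmentIntegral_sub_segmentIntegral F τ₀ (γ • τ₀) (γ • τ)
  linear_combination e2 + hinv

/-- A weight-two form with purely imaginary periods on a cocompact group vanishes (Shimura Thm. 8.4, injectivity half; maximum modulus for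
`exp ∘ ∫F` on the compact quotient).
-- adapted from Literature/NumberTheory/Automorphic/ShimuraCurvePeriodsHeckeIntegralityProofs.lean §3 (no hub olean for that module in this closure)
[cite: ShimuraIATAF1971, Thm. 8.4 p. 234] -/
private theorem coe_eq_zero_of_forall_re_period_eq_zero₄ {K : Set ℍ} (hK : IsCompact K)
    (hcov : ∀ τ : ℍ, ∃ γ ∈ Γ, γ • τ ∈ K) (F : CuspForm Γ 2) (τ₀ : ℍ)
    (H : ∀ γ ∈ Γ, (segmentIntegral F τ₀ (γ • τ₀)).re = 0) : (⇑F : ℍ → ℂ) = 0 := by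
  set Ψ : ℍ → ℂ := segmentIntegral F τ₀ with hΨdef
  have hinv : ∀ γ ∈ Γ, ∀ τ : ℍ, (Ψ (γ • τ)).re = (Ψ τ).re := by
    intro γ hγ τ
    rw [hΨdef, segmentIntegral_smul_eq_add_period₄ F hγ τ₀ τ, Complex.add_re, H γ hγ, add_zero]
  have hderiv : ∀ z : ℂ, 0 < z.im → HasDerivAt (Ψ ∘ ofComplex) (F (ofComplex z)) z :=
    fun z hz => hasDerivAt_segmentIntegral F τ₀ hz
  have hdiff : DifferentiableOn ℂ (Ψ ∘ ofComplex) {z : ℂ | 0 < z.im} :=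
    differentiableOn_segmentIntegral F τ₀
  have hΨc : Continuous Ψ := by
    have h2 : Ψ = (Ψ ∘ ofComplex) ∘ ((↑) : ℍ → ℂ) := by
      funext τ; simp [ofComplex_apply]
    rw [h2]
    exact hdiff.continuousOn.comp_continuous continuous_coe fun τ => τ.im_pos
  have hKne : K.Nonempty := by
    obtain ⟨γ, -, hγ⟩ := hcov UpperHalfPlane.I
    exact ⟨_, hγ⟩
  obtain ⟨k, hkK, hk⟩ := hK.exists_isMaxOn hKne (Complex.continuous_re.comp hΨc).continuousOn
  have hmax : ∀ τ : ℍ, (Ψ τ).re ≤ (Ψ k).re := by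
    intro τ
    obtain ⟨γ, hγ, hγτ⟩ := hcov τ
    rw [← hinv γ hγ τ]
    exact hk hγτ
  set f : ℂ → ℂ := fun z => Complex.exp ((Ψ ∘ ofComplex) z) with hfdef
  have hfd : DifferentiableOn ℂ f {z : ℂ | 0 < z.im} := hdiff.cexp
  have hkU : (k : ℂ) ∈ {z : ℂ | 0 < z.im} := k.im_pos
  have hfmax : IsMaxOn (norm ∘ f) {z : ℂ | 0 < z.im} (k : ℂ) := by
    intro z hz
    simp only [Function.comp_apply, hfdef, Complex.norm_exp, Set.mem_setOf_eq]
    refine Real.exp_le_exp.mpr ?_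
    rw [ofComplex_apply, ofComplex_apply_of_im_pos hz]
    exact hmax _
  have hconst := Complex.eqOn_of_isPreconnected_of_isMaxOn_norm
    (convex_halfSpace_im_gt 0).isPreconnected isOpen_upperHalfPlaneSet hfd hkU hfmax
  funext τ
  have hτ : 0 < (τ : ℂ).im := τ.im_pos
  have hd1 : HasDerivAt f (Complex.exp ((Ψ ∘ ofComplex) (τ : ℂ)) * F (ofComplex (τ : ℂ))) (τ : ℂ) :=
    (hderiv (τ : ℂ) hτ).cexp
  have hd2 : HasDerivAt f 0 (τ : ℂ) := by
    have hev : f =ᶠ[nhds (τ : ℂ)] fun _ => f (k : ℂ) :=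
      Filter.eventuallyEq_of_mem (isOpen_upperHalfPlaneSet.mem_nhds hτ) hconst
    exact (hasDerivAt_const (τ : ℂ) (f (k : ℂ))).congr_of_eventuallyEq hev
  have h0 := hd1.unique hd2
  rw [ofComplex_apply] at h0
  rcases mul_eq_zero.mp h0 with h1 | h1
  · exact absurd h1 (Complex.exp_ne_zero _)
  · simpa using h1

omit [Γ.HasDetOne] in
/-- `det = 1` is preserved under conjugation of the level. [folklore] -/
private theorem hasDetOne_conj_smul₄ (hΓ : Γ.HasDetOne) (x : GL (Fin 2) ℝ) : (toConjAct x • Γ).HasDetOne := by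
  refine ⟨fun {g} hg => ?_⟩
  obtain ⟨y, hy, rfl⟩ := (Subgroup.mem_smul_pointwise_iff_exists g _ _).mp hg
  haveI := hΓ
  rw [toConjAct_smul, map_mul, map_mul, map_inv, Subgroup.HasDetOne.det_eq hy, mul_one, mul_inv_cancel]

end Cocompact

/-! ## §2 The principal level `Γ̄(q)`: cocompact in the division case; Eichler–Shimura injectivity in both cases; finitely generated -/

section PrincipalLevel

variable {D M : ℕ} {C : Finset ℕ} (X : CartanLevelCurveData D M C) (q : ℕ)

/-- **`Γ̄(q)` is cocompact when `X.B` is a division algebra**: a compact subset of `ℍ` meets every `Γ̄(q)`-orbit (the cover group `ι(O₀'¹)` is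
cocompact, tree `exists_isCompact_forall_exists_mem_normOneUnits_smul_mem`; spread over the finitely many cosets of `Γ̄(q)`).
[cite: ShimuraIATAF1971, §9.2 p. 246 and §1.3 Prop. 1.31] [cite: VignerasLNM800, Ch. IV §1 Thm. 1.1] -/
theorem principalLevel_exists_isCompact_reps_of_forall_isUnit (hdiv : ∀ x : X.B, x ≠ 0 → IsUnit x) (hq0 : q ≠ 0) :
    ∃ K : Set ℍ, IsCompact K ∧ ∀ z : ℍ, ∃ γ ∈ principalLevel X q, γ • z ∈ K := by
  obtain ⟨K, hK, hcov⟩ :=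
    exists_isCompact_forall_exists_mem_normOneUnits_smul_mem X.B (coverOrder X q) (isOrder_coverOrder X q) X.ι hdiv
  obtain ⟨T, -, hT⟩ := exists_finset_leftCosets_principalLevel X q hq0
  exact exists_isCompact_reps_of_finset_leftCosets hK hcov T hT

/-- **Injectivity of the real period map on `S₂(Γ̄(q))`, division case** (cocompact quotient, maximum modulus). [cite: ShimuraIATAF1971, Thm. 8.4 p. 234] -/
theorem principalLevel_eq_zero_of_forall_rePeriod_eq_zero_of_forall_isUnit (hdiv : ∀ x : X.B, x ≠ 0 → IsUnit x) (hq0 : q ≠ 0)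
    (z₀ : ℍ) (F : CuspForm (principalLevel X q) 2) (hF : ∀ γ : principalLevel X q, CuspForm.rePeriod F z₀ γ = 0) : F = 0 := by
  obtain ⟨K, hK, hcov⟩ := principalLevel_exists_isCompact_reps_of_forall_isUnit X q hdiv hq0
  have h0 := coe_eq_zero_of_forall_re_period_eq_zero₄ hK hcov F z₀ fun γ hγ => by
    have h := hF ⟨γ, hγ⟩
    rwa [CuspForm.rePeriod_apply] at h
  exact DFunLike.coe_injective (h0.trans CuspForm.coe_zero.symm)

/-- **Injectivity of the real period map on `S₂(Γ̄(q))`, split case** (`X.B` has a non-zero non-unit): restrict to `g A g⁻¹ ⊓ Γ̄(q)` for the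
arithmetic conjugate `g A g⁻¹ ≤ ι(O₀'¹)` — still of finite index in `g A g⁻¹`, so `A ⊓ g⁻¹ Γ̄(q) g` is arithmetic — translate by `g`, and apply the
cusped injectivity theorem. [cite: ShimuraIATAF1971, Thm. 8.4 p. 234 and §9.2 p. 246] [cite: Bergeron2016, §2.2 Lemma 2.7 p. 41 and §2.3.1 p. 44] -/
theorem principalLevel_eq_zero_of_forall_rePeriod_eq_zero_of_exists_not_isUnit (hsplit : ∃ x : X.B, x ≠ 0 ∧ ¬ IsUnit x) (hq0 : q ≠ 0)
    (z₀ : ℍ) (F : CuspForm (principalLevel X q) 2) (hF : ∀ γ : principalLevel X q, CuspForm.rePeriod F z₀ γ = 0) : F = 0 := by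
  obtain ⟨A, g, hA, hA1, hdet, hle⟩ :=
    exists_isArithmetic_conj_le_normOneUnits_of_exists_not_isUnit X.B (coverOrder X q) (isOrder_coverOrder X q) X.ι hsplit
  -- `hle : g A g⁻¹ ≤ ι(O₀'¹) = coverUnits X q`
  set Δ : Subgroup (GL (Fin 2) ℝ) := toConjAct g • A ⊓ principalLevel X q with hΔdef
  have hΔle : Δ ≤ principalLevel X q := inf_le_right
  -- `Δ` has finite index in `g A g⁻¹`
  have h1 : (principalLevel X q).relIndex (toConjAct g • A) ≠ 0 := fun h =>
    (isFiniteRelIndex_principalLevel X q hq0).relIndex_ne_zero (Subgroup.relIndex_eq_zero_of_le_right hle h)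
  have h2 : Δ.relIndex (toConjAct g • A) ≠ 0 := by
    rw [hΔdef, Subgroup.inf_relIndex_left]
    exact h1
  have hgA : toConjAct g⁻¹ • (toConjAct g • A) = A := by
    rw [← mul_smul, ← map_mul, inv_mul_cancel, map_one, one_smul]
  -- so `g⁻¹ Δ g ≤ A` is arithmetic, with `det = 1`
  haveI hArith : (toConjAct g⁻¹ • Δ).IsArithmetic := by
    haveI := hA
    refine ⟨Subgroup.Commensurable.trans ⟨?_, ?_⟩ (Subgroup.IsArithmetic.is_commensurable (𝒢 := A))⟩
    · rw [← hgA, Subgroup.relIndex_pointwise_smul]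
      exact h2
    · have hle' : toConjAct g⁻¹ • Δ ≤ A := by
        rw [← hgA]
        exact Subgroup.pointwise_smul_le_pointwise_smul_iff.mpr inf_le_left
      rw [Subgroup.relIndex_eq_one.mpr hle']
      exact one_ne_zero
  have hΔ1 : Δ.HasDetOne := ⟨fun {x} hx => Subgroup.HasDetOne.det_eq (hΔle hx)⟩
  haveI : (toConjAct g⁻¹ • Δ).HasDetOne := hasDetOne_conj_smul₄ hΔ1 g⁻¹
  -- restriction of `F` to `Δ ≤ Γ̄(q)`
  let Fr : CuspForm Δ 2 :=
    { toFun := F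
      slash_action_eq' := fun γ hγ => SlashInvariantForm.slash_action_eqn F γ (hΔle hγ)
      holo' := F.holo'
      zero_at_cusps' := fun hc => F.zero_at_cusps' (hc.mono hΔle) }
  -- translate to the arithmetic level `g⁻¹ Δ g`
  set G : CuspForm (toConjAct g⁻¹ • Δ) 2 := CuspForm.translate Fr g with hGdef
  have hcoeG : (⇑G : ℍ → ℂ) = (⇑F : ℍ → ℂ) ∣[(2 : ℤ)] g := rfl
  -- the real periods of `G` at `g⁻¹ z₀` are real periods of `F` at `z₀`
  have hG : ∀ δ : ↥(toConjAct g⁻¹ • Δ), CuspForm.rePeriod G (g⁻¹ • z₀) δ = 0 := by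
    intro δ
    obtain ⟨y, hy, hyδ⟩ := (Subgroup.mem_smul_pointwise_iff_exists (δ : GL (Fin 2) ℝ) _ _).mp δ.2
    rw [CuspForm.rePeriod_apply, hcoeG, segmentIntegral_slash_eq F hdet]
    have e1 : g • g⁻¹ • z₀ = z₀ := smul_inv_smul g z₀
    have e2 : g • (δ : GL (Fin 2) ℝ) • g⁻¹ • z₀ = y • z₀ := by
      rw [← hyδ, toConjAct_smul, smul_smul, smul_smul]
      congr 1
      group
    rw [e1, e2]
    have hp := hF ⟨y, hΔle hy⟩
    rwa [CuspForm.rePeriod_apply] at hp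
  have hG0 : G = 0 := CuspForm.eq_zero_of_forall_rePeriod_eq_zero_of_isArithmetic (g⁻¹ • z₀) G hG
  have hF0 : (⇑F : ℍ → ℂ) = 0 := by
    have h3 : (⇑F : ℍ → ℂ) = ((⇑F : ℍ → ℂ) ∣[(2 : ℤ)] g) ∣[(2 : ℤ)] g⁻¹ := by
      rw [← SlashAction.slash_mul, mul_inv_cancel, SlashAction.slash_one]
    rw [h3, ← hcoeG, hG0, CuspForm.coe_zero, SlashAction.zero_slash]
  exact DFunLike.coe_injective (hF0.trans CuspForm.coe_zero.symm)

/-- **EICHLER–SHIMURA INJECTIVITY ON `S₂(Γ̄(q))` (every `D`)**: for `q ≠ 0`, a weight-two cusp form on the principal level `Γ̄(q)` of a Cartan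
datum all of whose real periods `Re ∫_{z₀}^{γ z₀} F` vanish is zero. [cite: ShimuraIATAF1971, Thm. 8.4 p. 234 and §9.2 p. 246] -/
theorem principalLevel_eq_zero_of_forall_rePeriod_eq_zero (hq0 : q ≠ 0) (z₀ : ℍ) (F : CuspForm (principalLevel X q) 2)
    (hF : ∀ γ : principalLevel X q, CuspForm.rePeriod F z₀ γ = 0) : F = 0 := by
  by_cases hdiv : ∀ x : X.B, x ≠ 0 → IsUnit x
  · exact principalLevel_eq_zero_of_forall_rePeriod_eq_zero_of_forall_isUnit X q hdiv hq0 z₀ F hF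
  · push Not at hdiv
    exact principalLevel_eq_zero_of_forall_rePeriod_eq_zero_of_exists_not_isUnit X q hdiv hq0 z₀ F hF

/-- The same with COMPLEX periods: a weight-two cusp form on `Γ̄(q)` all of whose periods `∫_{z₀}^{γ z₀} F` vanish is zero.
[cite: ShimuraIATAF1971, Thm. 8.4 p. 234] -/
theorem principalLevel_eq_zero_of_forall_period_eq_zero (hq0 : q ≠ 0) (z₀ : ℍ) (F : CuspForm (principalLevel X q) 2)
    (hF : ∀ γ : principalLevel X q, CuspForm.period F z₀ γ = 0) : F = 0 :=
  principalLevel_eq_zero_of_forall_rePeriod_eq_zero X q hq0 z₀ F fun γ => by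
    change (CuspForm.period F z₀ γ).re = 0
    rw [hF γ, Complex.zero_re]

/-- **`Γ̄(q)` IS FINITELY GENERATED** (`q ≠ 0`): the cover group `ι(O₀'¹)` is (tree `groupFG_normOneUnits`) and `Γ̄(q)` has finite index in it (Schreier).
[cite: ShimuraIATAF1971, §9.2 p. 246 and Prop. 1.31] [cite: Bergeron2016, §2.2 Thm. 2.3 (2) p. 36] -/
theorem fg_principalLevel (hq0 : q ≠ 0) : Group.FG (principalLevel X q) := by
  haveI : Group.FG (coverUnits X q) := groupFG_normOneUnits X.ι (isOrder_coverOrder X q)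
  haveI := finiteIndex_principalLevel_subgroupOf X q hq0
  haveI : Group.FG ((principalLevel X q).subgroupOf (coverUnits X q)) := Subgroup.fg_of_index_ne_zero _
  exact Group.fg_of_surjective (f := (Subgroup.subgroupOfEquivOfLe (principalLevel_le_coverUnits X q)).toMonoidHom)
    (Subgroup.subgroupOfEquivOfLe (principalLevel_le_coverUnits X q)).surjective

end PrincipalLevel

end Summit.BirchSwinnertonDyer.BirchSwinnertonDyer.Theorems.CartanCover.PrintClauses

end
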